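import Mathlib
import Summits.Ventures.PercRepro2.SwOutAll
import Summits.Ventures.PercRepro2.SwOutSeriesDefs
import Summits.Ventures.PercRepro2.SwOutSeriesContract
import Summits.Ventures.PercRepro2.SwOutSeriesContractCount
import Summits.Ventures.PercRepro2.SwOutSeriesDelete
import Summits.Ventures.PercRepro2.SwOutSeriesDeleteCount
import Summits.Ventures.PercRepro2.SwOutSeriesThm
import Summits.Ventures.PercRepro2.SwOutLeaf
import Summits.Ventures.PercRepro2.SwOutLeafThm
import Summits.Ventures.PercRepro2.SwOutLoop
import Summits.Ventures.PercRepro2.SwOutLoopThm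
import Summits.Ventures.PercRepro2.SwOutReducible
import Summits.Ventures.PercRepro2.SwOutCyclicDefs
import Summits.Ventures.PercRepro2.SwOutAdjThm
import Summits.Ventures.PercRepro2.SwOutAdjIndDefs

/-!
# Regions with a set of junctions are reducible; (SW) with junctions and path vertices (blind
cell PercRepro2, night-4 g11, 2026-08-25; proofs/NIGHT4-G11.md §5(5))

The set version of `SwOutJunctionInd`.  **`reducible_of_adjJunctionRegion`**: every junction
region for a set `J` (adjacent junctions allowed; every neighbour `p ≠ h` of a junction adjacent
to `h`; every other vertex with an outside edge or a path vertex) is series-reducible — strong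
induction on the bad edges: a loop at `h` or at `J` or at a path vertex is parked, a path vertex
with one edge is peeled, with two edges contracted / deleted; when no bad edge is left the
adjacent-junction theorem is the base.  **`sw_of_adjJunctionRegion`**: row (SW) on every graph
whose region `V ∖ {l}` is a junction region for `J` — every vertex other than `l, h, o` outside `J`
is joined to `l` or has at most two edges among the vertices other than `l`, and the junctions
(not joined to `l`, without loops) have all their neighbours other than `h` joined to `h`.
-/

namespace Summit.Ventures.PercRepro2

namespace LocRows

open Hull

variable {V : Type*} {E : Type*} [Fintype E] [DecidableEq E]

open scoped Classical

variable {ends : E → Sym2 V} {l h o : V} {J : Set V}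

section Main

variable (hlh : l ≠ h) (hhJ : h ∉ J) (hlJ : l ∉ J)
include hlh hhJ hlJ

/-- **Junction regions for a set of junctions are series-reducible** (induction on the bad
edges). -/
theorem reducible_of_adjJunctionRegion (n : ℕ) :
    ∀ (ends : E → Sym2 V) (U : Set V), (badEdgesJS ends h o J U).card = n → l ∉ U → h ∈ U →
      J ⊆ U → JunctionRegionS ends h o J U → JunctionAdjS ends h J → Reducible l h o ends U := by
  induction n using Nat.strong_induction_on with
  | _ n ih =>
  intro ends U hn hl hU hJU hcyc hJ
  by_cases hbad : badEdgesJS ends h o J U = ∅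
  · -- BASE: no bad edge — the adjacent-junction theorem
    refine Reducible.base ends U fun ξ 𝓔 h𝓔 =>
      rigidOK_of_adjJunctions (ξ := ξ) hl ?_ hJU hhJ (hadj_of_junctionAdjS hJ) ?_ h𝓔
    · intro e he
      have : e ∈ badEdgesJS ends h o J U := mem_badEdgesJS.2 (Or.inr (Or.inl he))
      exact absurd this (by rw [hbad]; exact Finset.notMem_empty e)
    · intro x hxU hxh hxo hxJ
      by_cases hx : HasOut ends U x
      · exact Or.inl hx
      · right
        intro e hxe
        have : e ∈ badEdgesJS ends h o J U :=
          mem_badEdgesJS.2 (Or.inl ⟨x, hxe, hxU, hxh, hxo, hxJ, hx⟩)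
        exact absurd this (by rw [hbad]; exact Finset.notMem_empty e)
  obtain ⟨e₀, he₀⟩ := Finset.nonempty_iff_ne_empty.2 hbad
  -- parking a loop at a vertex `v ∈ U`, `v ≠ u`: the general step
  have hpark : ∀ (v : V) (e₁ : E), ends e₁ = s(v, v) → v ∈ U → e₁ ∈ badEdgesJS ends h o J U →
      Reducible l h o ends U := by
    intro v e₁ he₁ hvU he₁bad
    have hout : ∀ y ∈ U, HasOut ends U y → HasOut (parkLoop ends l e₁) U y := by
      intro y _ hy
      refine hasOut_transfer (subset_refl U) ?_ hy
      intro e' ⟨z, hz, hzU⟩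
      have : e' ≠ e₁ := by
        rintro rfl
        rw [he₁, Sym2.mem_iff] at hz
        rcases hz with rfl | rfl <;> exact hzU hvU
      exact parkLoop_apply_of_ne this
    refine Reducible.loop ends U v e₁ he₁ hvU hl (ih _ ?_ _ _ rfl hl hU hJU ?_ ?_)
    · rw [← hn]
      refine card_badEdgesJS_lt he₁bad ?_
      intro e he
      rw [Finset.mem_erase]
      have hne : e ≠ e₁ := by
        rintro rfl
        rw [mem_badEdgesJS, parkLoop_apply_e₁] at he
        rcases he with ⟨y, hy, hyU, _⟩ | hll | ⟨u, huJ, hll⟩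
        · rw [Sym2.mem_iff] at hy
          rcases hy with rfl | rfl <;> exact hl hyU
        · rw [Sym2.eq_iff] at hll
          rcases hll with ⟨h', _⟩ | ⟨h', _⟩ <;> exact hlh h'
        · rw [Sym2.eq_iff] at hll
          rcases hll with ⟨h', _⟩ | ⟨h', _⟩ <;> exact hlJ (h' ▸ huJ)
      exact ⟨hne, mem_badEdgesJS_of_agree (subset_refl U) hout (parkLoop_apply_of_ne hne) he⟩
    · -- the parked graph is a junction region
      refine junctionRegionS_update_loop (subset_refl U) hcyc hout ?_ ?_
      · intro y hyU _ _ _ e' hy'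
        have h' : e' ≠ e₁ := by
          rintro rfl
          rw [parkLoop_apply_e₁, Sym2.mem_iff] at hy'
          rcases hy' with rfl | rfl <;> exact absurd hyU hl
        exact parkLoop_apply_of_ne h'
      · intro y hyU _ _ _ hin' e hy' z hz
        have h' : e ≠ e₁ := by
          rintro rfl
          rw [parkLoop_apply_e₁, Sym2.mem_iff] at hy'
          rcases hy' with rfl | rfl <;> exact absurd hyU hl
        rw [parkLoop_apply_of_ne h'] at hy' hz
        exact hin' e hy' z hz
    · exact junctionAdjS_parkLoop hJ he₁ hlJ
  rcases mem_badEdgesJS.1 he₀ with ⟨x, hxe₀, hxU, hxh, hxo, hxJ, hxout⟩ | hloop₀ | ⟨u, huJ, hloop₀⟩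
  · -- a bad vertex `x ∉ J` with the edge `e₀`: a path vertex
    have hxl : x ≠ l := by rintro rfl; exact hl hxU
    rcases hcyc x hxU hxh hxo hxJ with hout | ⟨hin, hcard⟩
    · exact absurd hout hxout
    by_cases hloopx : ∃ e, ends e = s(x, x)
    · -- (B1) a loop at `x`: park it
      obtain ⟨e₁, he₁⟩ := hloopx
      exact hpark x e₁ he₁ hxU (mem_badEdgesJS.2
        (Or.inl ⟨x, by rw [he₁]; exact Sym2.mem_mk_left x x, hxU, hxh, hxo, hxJ, hxout⟩))
    · -- no loop at `x`: one or two edges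
      have hloopx' : ∀ e, ends e ≠ s(x, x) := fun e he => hloopx ⟨e, he⟩
      obtain ⟨p, hp⟩ := Sym2.mem_iff_exists.1 hxe₀
      have hpx : p ≠ x := fun h' => hloopx' e₀ (by rw [hp, h'])
      have hpU : p ∈ U := hin e₀ hxe₀ p (by rw [hp]; exact Sym2.mem_mk_right x p)
      have he₀at : e₀ ∈ edgesAt ends x := mem_edgesAt.2 hxe₀
      have hUx : U \ {x} ⊆ U := Set.sdiff_subset
      have hlx : l ∉ U \ {x} := fun h' => hl h'.1
      have hUx' : h ∈ U \ {x} := ⟨hU, fun h' => hxh (Set.mem_singleton_iff.1 h').symm⟩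
      have hJUx : J ⊆ U \ {x} :=
        fun u hu => ⟨hJU hu, fun h' => hxJ ((Set.mem_singleton_iff.1 h') ▸ hu)⟩
      -- a neighbour of `u` is never `x`, and a witness is never at `x`, unless `x` carries the
      -- edge in question: `x` has at most the edges at hand
      rcases Nat.lt_or_ge (edgesAt ends x).card 2 with hlt | hge
      · -- (B2) one edge: a leaf
        have hone : edgesAt ends x = {e₀} := by
          have hpos : 0 < (edgesAt ends x).card := Finset.card_pos.2 ⟨e₀, he₀at⟩
          have : (edgesAt ends x).card = 1 := by omega
          obtain ⟨a, ha⟩ := Finset.card_eq_one.1 this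
          rw [ha] at he₀at ⊢
          rw [Finset.mem_singleton] at he₀at
          rw [he₀at]
        have honly : ∀ e, x ∈ ends e → e = e₀ := fun e he => by
          have : e ∈ edgesAt ends x := mem_edgesAt.2 he
          rw [hone, Finset.mem_singleton] at this; exact this
        have hs : IsLeafAt ends x p e₀ := ⟨hp, hpx.symm, honly⟩
        have hout : ∀ y ∈ U \ {x}, HasOut ends U y → HasOut (deleteLeaf ends x e₀) (U \ {x}) y := by
          intro y _ hy
          refine hasOut_transfer hUx ?_ hy
          intro e' ⟨z, hz, hzU⟩
          have : e' ≠ e₀ := by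
            rintro rfl
            rw [hp, Sym2.mem_iff] at hz
            rcases hz with rfl | rfl
            · exact hzU hxU
            · exact hzU hpU
          exact deleteLeaf_apply_of_ne this
        refine Reducible.leaf ends U x p e₀ hs hxU hxh hxl hxo
          (ih _ ?_ _ _ rfl hlx hUx' hJUx ?_ ?_)
        · rw [← hn]
          refine card_badEdgesJS_lt he₀ ?_
          intro e he
          rw [Finset.mem_erase]
          have hne : e ≠ e₀ := by
            rintro rfl
            rw [mem_badEdgesJS, deleteLeaf_apply_e₁] at he
            rcases he with ⟨y, hy, hyU, _⟩ | hll | ⟨u, huJ, hll⟩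
            · rw [Sym2.mem_iff] at hy
              rcases hy with rfl | rfl <;> exact hyU.2 rfl
            · rw [Sym2.eq_iff] at hll
              rcases hll with ⟨h', _⟩ | ⟨h', _⟩ <;> exact hxh h'
            · rw [Sym2.eq_iff] at hll
              rcases hll with ⟨h', _⟩ | ⟨h', _⟩ <;> exact hxJ (h' ▸ huJ)
          exact ⟨hne, mem_badEdgesJS_of_agree hUx hout (deleteLeaf_apply_of_ne hne) he⟩
        · refine junctionRegionS_update_loop hUx hcyc hout ?_ ?_
          · intro y hyU _ _ _ e' hy'
            have h' : e' ≠ e₀ := by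
              rintro rfl
              rw [deleteLeaf_apply_e₁, Sym2.mem_iff] at hy'
              rcases hy' with rfl | rfl <;> exact absurd rfl hyU.2
            exact deleteLeaf_apply_of_ne h'
          · intro y hyU _ _ _ hin' e hy' z hz
            have h' : e ≠ e₀ := by
              rintro rfl
              rw [deleteLeaf_apply_e₁, Sym2.mem_iff] at hy'
              rcases hy' with rfl | rfl <;> exact absurd rfl hyU.2
            rw [deleteLeaf_apply_of_ne h'] at hy' hz
            refine ⟨hin' e hy' z hz, ?_⟩
            rintro rfl
            exact h' (honly e hz)
        · -- the junction condition: `e₀` is not at `J`, and a witness `(p', h)` is not `e₀`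
          refine junctionAdjS_update_loop hJ hxJ ?_
          intro u _ p' hp' _ e hep
          rw [hp, Sym2.eq_iff] at hp'
          rcases hp' with ⟨rfl, _⟩ | ⟨h1, _⟩
          · -- `x = p'` is the other end of `e`, so `e` is at `x`: `e = e₀`
            exact honly e (by rw [hep]; exact Sym2.mem_mk_right u x)
          · exact absurd h1 hxh
      · -- (B3) two edges: a series vertex
        have htwo : (edgesAt ends x).card = 2 := le_antisymm hcard hge
        obtain ⟨a, b, hab, hS⟩ := Finset.card_eq_two.1 htwo
        obtain ⟨e₁, hne, hS'⟩ : ∃ e₁, e₀ ≠ e₁ ∧ edgesAt ends x = {e₀, e₁} := by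
          rw [hS] at he₀at
          rw [Finset.mem_insert, Finset.mem_singleton] at he₀at
          rcases he₀at with rfl | rfl
          · exact ⟨b, hab, hS⟩
          · exact ⟨a, hab.symm, by rw [hS, Finset.pair_comm]⟩
        have hxe₁ : x ∈ ends e₁ := mem_edgesAt.1 (by
          rw [hS']; exact Finset.mem_insert_of_mem (Finset.mem_singleton_self e₁))
        obtain ⟨q, hq⟩ := Sym2.mem_iff_exists.1 hxe₁
        have hqx : q ≠ x := fun h' => hloopx' e₁ (by rw [hq, h'])
        have hqU : q ∈ U := hin e₁ hxe₁ q (by rw [hq]; exact Sym2.mem_mk_right x q)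
        have honly : ∀ e, x ∈ ends e → e = e₀ ∨ e = e₁ := by
          intro e he
          have : e ∈ edgesAt ends x := mem_edgesAt.2 he
          rw [hS', Finset.mem_insert, Finset.mem_singleton] at this; exact this
        have hs : IsSeriesAt ends x p q e₀ e₁ := ⟨hp, hq, hne, hpx.symm, hqx.symm, honly⟩
        have hnot : ∀ e', (∃ z ∈ ends e', z ∉ U) → e' ≠ e₀ ∧ e' ≠ e₁ := by
          rintro e' ⟨z, hz, hzU⟩
          constructor
          · rintro rfl
            rw [hp, Sym2.mem_iff] at hz
            rcases hz with rfl | rfl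
            · exact hzU hxU
            · exact hzU hpU
          · rintro rfl
            rw [hq, Sym2.mem_iff] at hz
            rcases hz with rfl | rfl
            · exact hzU hxU
            · exact hzU hqU
        have he₁bad : e₁ ∈ badEdgesJS ends h o J U :=
          mem_badEdgesJS.2 (Or.inl ⟨x, hxe₁, hxU, hxh, hxo, hxJ, hxout⟩)
        -- a neighbour `p'` of a junction `u` (by an edge `e` not at `x`) and its witness
        -- `(p', h)`: neither is `e₀` or `e₁`, since both have `x` as an endpoint and `x` carries
        -- only `e₀, e₁`
        have hwit : ∀ u ∈ J, ∀ e p', ends e = s(u, p') → p' ≠ h → e ≠ e₀ → e ≠ e₁ →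
            ∀ e', ends e' = s(p', h) → e' ≠ e₀ ∧ e' ≠ e₁ := by
          intro u _ e p' hep hph he0 he1 e' he'
          have hp'x : p' ≠ x := by
            rintro rfl
            have hxe : p' ∈ ends e := by rw [hep]; exact Sym2.mem_mk_right u p'
            rcases honly e hxe with rfl | rfl
            · exact he0 rfl
            · exact he1 rfl
          constructor
          · rintro rfl
            rw [hp, Sym2.eq_iff] at he'
            rcases he' with ⟨h1, _⟩ | ⟨h1, _⟩
            · exact hp'x h1.symm
            · exact hxh h1
          · rintro rfl
            rw [hq, Sym2.eq_iff] at he'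
            rcases he' with ⟨h1, _⟩ | ⟨h1, _⟩
            · exact hp'x h1.symm
            · exact hxh h1
        -- CONTRACTION
        have houtC : ∀ y ∈ U \ {x}, HasOut ends U y →
            HasOut (contractSeries ends x p q e₀ e₁) (U \ {x}) y := by
          intro y _ hy
          refine hasOut_transfer hUx ?_ hy
          intro e' hz
          exact contractSeries_apply_of_ne (hnot e' hz).1 (hnot e' hz).2
        have hcardC : (badEdgesJS (contractSeries ends x p q e₀ e₁) h o J (U \ {x})).card < n := by
          rw [← hn]
          refine card_badEdgesJS_lt he₀ ?_
          intro e he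
          rw [Finset.mem_erase]
          have hne₀ : e ≠ e₀ := by
            rintro rfl
            rw [mem_badEdgesJS, contractSeries_apply_e₁] at he
            rcases he with ⟨y, hy, hyU, _⟩ | hll | ⟨u, huJ, hll⟩
            · rw [Sym2.mem_iff] at hy
              rcases hy with rfl | rfl <;> exact hyU.2 rfl
            · rw [Sym2.eq_iff] at hll
              rcases hll with ⟨h', _⟩ | ⟨h', _⟩ <;> exact hxh h'
            · rw [Sym2.eq_iff] at hll
              rcases hll with ⟨h', _⟩ | ⟨h', _⟩ <;> exact hxJ (h' ▸ huJ)
          refine ⟨hne₀, ?_⟩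
          by_cases hne₁ : e = e₁
          · subst hne₁; exact he₁bad
          · exact mem_badEdgesJS_of_agree hUx houtC (contractSeries_apply_of_ne hne₀ hne₁) he
        have hcycC := junctionRegionS_contract hcyc hne hp hq hpx hqx hpU hqU hin honly houtC
        -- the junction condition after the contraction: the new edge `(p, q)` is at a junction
        -- `u` only as `(u, h)` (the series neighbour `x` of `u` is adjacent to `h` through its
        -- other edge)
        have hJC : JunctionAdjS (contractSeries ends x p q e₀ e₁) h J := by
          have hnotC : ∀ u ∈ J, ∀ e p', contractSeries ends x p q e₀ e₁ e = s(u, p') → p' ≠ h →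
              e ≠ e₀ ∧ e ≠ e₁ := by
            intro u huJ e p' hep hph
            constructor
            · rintro rfl
              rw [contractSeries_apply_e₁, Sym2.eq_iff] at hep
              rcases hep with ⟨h1, _⟩ | ⟨_, h1⟩ <;> exact hxJ (h1 ▸ huJ)
            · rintro rfl
              rw [contractSeries_apply_e₂ hne] at hep
              exact contracted_not_at_J hs hxh hhJ hJ huJ hep hph
          refine junctionAdjS_of_agree hJ ?_ ?_
          · intro u huJ e p' hep hph
            obtain ⟨hne₀, hne₁⟩ := hnotC u huJ e p' hep hph
            rw [contractSeries_apply_of_ne hne₀ hne₁]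
          · intro u huJ e p' hep hph e' he'
            obtain ⟨hne₀, hne₁⟩ := hnotC u huJ e p' hep hph
            rw [contractSeries_apply_of_ne hne₀ hne₁] at hep
            obtain ⟨h0, h1⟩ := hwit u huJ e p' hep hph hne₀ hne₁ e' he'
            rw [contractSeries_apply_of_ne h0 h1]
        -- DELETION
        have houtD : ∀ y ∈ U \ {x}, HasOut ends U y →
            HasOut (deleteSeries ends x e₀ e₁) (U \ {x}) y := by
          intro y _ hy
          refine hasOut_transfer hUx ?_ hy
          intro e' hz
          exact deleteSeries_apply_of_ne (hnot e' hz).1 (hnot e' hz).2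
        have hcardD : (badEdgesJS (deleteSeries ends x e₀ e₁) h o J (U \ {x})).card < n := by
          rw [← hn]
          refine card_badEdgesJS_lt he₀ ?_
          intro e he
          rw [Finset.mem_erase]
          have hnotbad : ∀ e', deleteSeries ends x e₀ e₁ e' = s(x, x) →
              e' ∉ badEdgesJS (deleteSeries ends x e₀ e₁) h o J (U \ {x}) := by
            intro e' he' hb
            rw [mem_badEdgesJS, he'] at hb
            rcases hb with ⟨y, hy, hyU, _⟩ | hll | ⟨u, huJ, hll⟩
            · rw [Sym2.mem_iff] at hy
              rcases hy with rfl | rfl <;> exact hyU.2 rfl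
            · rw [Sym2.eq_iff] at hll
              rcases hll with ⟨h', _⟩ | ⟨h', _⟩ <;> exact hxh h'
            · rw [Sym2.eq_iff] at hll
              rcases hll with ⟨h', _⟩ | ⟨h', _⟩ <;> exact hxJ (h' ▸ huJ)
          have hne₀ : e ≠ e₀ := by rintro rfl; exact hnotbad _ deleteSeries_apply_e₁ he
          have hne₁ : e ≠ e₁ := by rintro rfl; exact hnotbad _ (deleteSeries_apply_e₂ hne) he
          exact ⟨hne₀, mem_badEdgesJS_of_agree hUx houtD (deleteSeries_apply_of_ne hne₀ hne₁) he⟩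
        have hcycD := junctionRegionS_delete hcyc hne hin honly houtD
        have hJD : JunctionAdjS (deleteSeries ends x e₀ e₁) h J := by
          refine junctionAdjS_of_agree hJ ?_ ?_
          · intro u huJ e p' hep hph
            have hne₀ : e ≠ e₀ := by
              rintro rfl
              rw [deleteSeries_apply_e₁, Sym2.eq_iff] at hep
              rcases hep with ⟨h1, _⟩ | ⟨_, h1⟩ <;> exact hxJ (h1 ▸ huJ)
            have hne₁ : e ≠ e₁ := by
              rintro rfl
              rw [deleteSeries_apply_e₂ hne, Sym2.eq_iff] at hep
              rcases hep with ⟨h1, _⟩ | ⟨_, h1⟩ <;> exact hxJ (h1 ▸ huJ)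
            rw [deleteSeries_apply_of_ne hne₀ hne₁]
          · intro u huJ e p' hep hph e' he'
            have hne₀ : e ≠ e₀ := by
              rintro rfl
              rw [deleteSeries_apply_e₁, Sym2.eq_iff] at hep
              rcases hep with ⟨h1, _⟩ | ⟨_, h1⟩ <;> exact hxJ (h1 ▸ huJ)
            have hne₁ : e ≠ e₁ := by
              rintro rfl
              rw [deleteSeries_apply_e₂ hne, Sym2.eq_iff] at hep
              rcases hep with ⟨h1, _⟩ | ⟨_, h1⟩ <;> exact hxJ (h1 ▸ huJ)
            rw [deleteSeries_apply_of_ne hne₀ hne₁] at hep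
            obtain ⟨h0, h1⟩ := hwit u huJ e p' hep hph hne₀ hne₁ e' he'
            rw [deleteSeries_apply_of_ne h0 h1]
        exact Reducible.series ends U x p q e₀ e₁ hs hxU hpU hxh hxl hxo
          (ih _ hcardC _ _ rfl hlx hUx' hJUx hcycC hJC) (ih _ hcardD _ _ rfl hlx hUx' hJUx hcycD hJD)
  · -- a loop at `h`: park it
    exact hpark h e₀ hloop₀ hU he₀
  · -- a loop at a junction `u`: park it
    exact hpark u e₀ hloop₀ (hJU huJ) he₀

/-- **Row (SW) on every graph whose region `V ∖ {l}` is a junction region for a set `J`**: every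
vertex other than `l, h, o` outside `J` is joined to `l` or has at most two edges (all among the
vertices other than `l`), and the junctions (not joined to `l`) have all their neighbours other
than `h` joined to `h`. -/
theorem sw_of_adjJunctionRegion (ends : E → Sym2 V) (hcyc : JunctionRegionS ends h o J ({l}ᶜ))
    (hJ : JunctionAdjS ends h J) : Sw ends l h o :=
  sw_of_reducible l h o hlh
    (reducible_of_adjJunctionRegion hlh hhJ hlJ _ ends ({l}ᶜ) rfl (by simp)
      (by simpa using hlh.symm) (fun u hu => by
        simp only [Set.mem_compl_iff, Set.mem_singleton_iff]
        rintro rfl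
        exact hlJ hu) hcyc hJ)

end Main

end LocRows

end Summit.Ventures.PercRepro2
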